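import Summits.QuantumFields.BalabanUV.Beta.GAN24.RespGaugeStencil

/-!
# `BalabanUV.Beta.GAN24.WilsonCurrentSym` — binder row G-an2-4 ∕ (CONV-C), W-slot CT-W, conservation law (C)∕(C)sym AT ALL LEVELS, THE BASE OF THE (A)-TOWER of this lineage's note
# `HOME/b2b-balaban-gan24-formalise-leaf-04/g68/EXIT-FACE-CURRENT-TOWER.md` §2 (I6): **THE SLOT↔LEG-SYMMETRISED BIWEIGHTED CURRENT OF an3's CUBIC WILSON TABLE VANISHES AT EVERY FREE
# LEG, WEIGHTED LEG FIRST** — 35 `RespGaugeStencil.tsum_pair_faceface_wilsonA_add_swap` (free leg first, pair `tsum`) moved to the (A)-tower's convention by an2's `wilsonA_antisymm`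
# and the pair∕iterated exchange on its finite support; the multiplier free leg is empty.

NOT IN PRINT; OUR BOOKKEEPING ([folklore] BY NAME: 35 `RespGaugeStencil.tsum_pair_faceface_wilsonA_add_swap ∕ summable_pair_faceface_wilsonA`, an2's `StepJetData.wilsonA_antisymm`;
G-an2-4 formalisation swarm, leaf prover `b2b-balaban-gan24-formalise-leaf-04`, gen 69).  HONEST FRAMING (cell contract, verbatim): «discharging `BetaPertH` makes Bałaban's UV stability
UNCONDITIONAL — a real constructive-QFT result; it is NOT the continuum limit and NOT the Clay problem.»  HONEST DEPENDENCY (verbatim): «continuum YM on T⁴ ⇐ BetaPertH ∧ nine spine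
estimates (0/9 proved); BetaPertH ⇐ (D1) ∧ (D4) ∧ CAP+tail; G-an2-4 gates asym, D1 and NE2/3/4.»

CONVENTION (as in `CubicSectorCurrentSym`): `P_T[s,h](p,a) := Σ'_q h(q_β)·Σ'_u s(u_ν)·T ν u q p (inl β) a + Σ'_q s(q_ν)·Σ'_u h(u_β)·T β u q p (inl ν) a`.

WHAT ([folklore]; generic `d`, ARBITRARY single-coordinate profiles `h s : ℤ → ℝ`; 0 `def`, 0 cited facts, 0 `def … : Prop`, 0 sorry): `wilsonA_inl_inr'` (no multiplier second leg),
`tsum_tsum_wilsonA_eq_neg_pair` (iterated weighted-leg-first current = minus 35's pair current), **`sym_wilsonA`** (`P_{wilsonA d}[s,h](p,a) = 0`, every `p a`).  Asserts NO value of Bałaban's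
tables beyond an3's DEFINED `wilsonA`; discharges NOTHING of (C)sym ∕ (Q-D) ∕ (Q-D-rate) ∕ «T2Shape» ∕ «T2Drift» ∕ (hW, hWall); NEVER «G-an2-4 closed» as (CONV-C); NOT D1, NOT `BetaPertH`,
NOT continuum, NOT Clay.  2026-08-23; no existing file touched.
-/

noncomputable section

open Finset
open scoped BigOperators
open Literature.MathematicalPhysics.QuantumFieldTheory
open Literature.MathematicalPhysics.QuantumFieldTheory.Balaban1983to89
open Literature.MathematicalPhysics.QuantumFieldTheory.Balaban1983to89.Beta
open AffineAveraging (Site)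
open OneStepResolventKernel (Fib)
open StepJetData (wilsonA wilsonA_antisymm)
open Summit.QuantumFields.BalabanUV.Beta.GAN24.RespGaugeStencil (tsum_pair_faceface_wilsonA_add_swap summable_pair_faceface_wilsonA)

namespace Summit.QuantumFields.BalabanUV.Beta.GAN24.WilsonCurrentSym

variable {d : ℕ}

/-- [folklore] The cubic Wilson table has no multiplier second leg: `wilsonA d κ u x z (inl a) (inr m) = 0`. -/
theorem wilsonA_inl_inr' (κ : Fin (d + 1)) (u x z : Site (d + 1)) (a m : Fin (d + 1)) : wilsonA d κ u x z (Sum.inl a) (Sum.inr m) = 0 := rfl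

/-- [folklore] **THE ITERATED WEIGHTED-LEG-FIRST CURRENT IS MINUS 35's PAIR CURRENT**:
`Σ'_q h(q_β)·Σ'_u s(u_ν)·wilsonA d ν u q p (inl β)(inl b) = −Σ'_{(t,w)} s(t_ν)·h(w_β)·wilsonA d ν t p w (inl b)(inl β)` (antisymmetry + Fubini on the finite support). -/
theorem tsum_tsum_wilsonA_eq_neg_pair (ν β b : Fin (d + 1)) (s h : ℤ → ℝ) (p : Site (d + 1)) :
    ∑' q : Site (d + 1), h (q β) * ∑' u : Site (d + 1), s (u ν) * wilsonA d ν u q p (Sum.inl β) (Sum.inl b) =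
      -∑' tw : Site (d + 1) × Site (d + 1), s (tw.1 ν) * h (tw.2 β) * wilsonA d ν tw.1 p tw.2 (Sum.inl b) (Sum.inl β) := by
  have hs := summable_pair_faceface_wilsonA (d := d) ν β s h b p
  have hs' : Summable fun wt : Site (d + 1) × Site (d + 1) => s (wt.2 ν) * h (wt.1 β) * wilsonA d ν wt.2 p wt.1 (Sum.inl b) (Sum.inl β) :=
    ((Equiv.prodComm (Site (d + 1)) (Site (d + 1))).summable_iff.2 hs).congr fun wt => by simp
  have e : ∀ q u : Site (d + 1), s (u ν) * wilsonA d ν u q p (Sum.inl β) (Sum.inl b) = -(s (u ν) * wilsonA d ν u p q (Sum.inl b) (Sum.inl β)) := by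
    intro q u
    rw [show wilsonA d ν u q p (Sum.inl β) (Sum.inl b) = -wilsonA d ν u p q (Sum.inl b) (Sum.inl β) from wilsonA_antisymm ν u p q (Sum.inl b) (Sum.inl β)]
    ring
  calc ∑' q : Site (d + 1), h (q β) * ∑' u : Site (d + 1), s (u ν) * wilsonA d ν u q p (Sum.inl β) (Sum.inl b)
      = ∑' q : Site (d + 1), ∑' u : Site (d + 1), -(s (u ν) * h (q β) * wilsonA d ν u p q (Sum.inl b) (Sum.inl β)) := by
        refine tsum_congr fun q => ?_
        rw [← tsum_mul_left]
        exact tsum_congr fun u => by rw [e q u]; ring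
    _ = -∑' q : Site (d + 1), ∑' u : Site (d + 1), s (u ν) * h (q β) * wilsonA d ν u p q (Sum.inl b) (Sum.inl β) := by
        rw [← tsum_neg]; exact tsum_congr fun q => tsum_neg
    _ = -∑' wt : Site (d + 1) × Site (d + 1), s (wt.2 ν) * h (wt.1 β) * wilsonA d ν wt.2 p wt.1 (Sum.inl b) (Sum.inl β) := by rw [hs'.tsum_prod]
    _ = _ := by
        rw [← (Equiv.prodComm (Site (d + 1)) (Site (d + 1))).tsum_eq (fun wt : Site (d + 1) × Site (d + 1) => s (wt.2 ν) * h (wt.1 β) * wilsonA d ν wt.2 p wt.1 (Sum.inl b) (Sum.inl β))]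
        exact congrArg Neg.neg (tsum_congr fun tw => by simp [Equiv.prodComm_apply])

/-- [folklore] **THE BASE OF THE (A)-TOWER**: for ARBITRARY single-coordinate profiles `s` (slot direction `ν`) and `h` (leg direction `β`) and every free leg `(p, a)`,
`Σ'_q h(q_β)·Σ'_u s(u_ν)·wilsonA d ν u q p (inl β) a + Σ'_q s(q_ν)·Σ'_u h(u_β)·wilsonA d β u q p (inl ν) a = 0`. -/
theorem sym_wilsonA (ν β : Fin (d + 1)) (s h : ℤ → ℝ) (p : Site (d + 1)) (a : Fib d) :
    (∑' q : Site (d + 1), h (q β) * ∑' u : Site (d + 1), s (u ν) * wilsonA d ν u q p (Sum.inl β) a) +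
      ∑' q : Site (d + 1), s (q ν) * ∑' u : Site (d + 1), h (u β) * wilsonA d β u q p (Sum.inl ν) a = 0 := by
  rcases a with b | m
  · rw [tsum_tsum_wilsonA_eq_neg_pair ν β b s h p, tsum_tsum_wilsonA_eq_neg_pair β ν b h s p, ← neg_add, neg_eq_zero]
    exact tsum_pair_faceface_wilsonA_add_swap (d := d) ν β s h b p
  · simp only [wilsonA_inl_inr', mul_zero, tsum_zero, add_zero]

end Summit.QuantumFields.BalabanUV.Beta.GAN24.WilsonCurrentSym

end
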